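import Summits.NavierStokesRegularity.NavierStokesRegularity.Theorems.TypeIIInviscidRelaxationAxisymSwirlRegularSplitTightness
import Summits.NavierStokesRegularity.NavierStokesRegularity.Theorems.ScenarioCensusRowF5lgGate
import Literature.Analysis.FluidPDE.ClassicalSolutionRescale
import Literature.Analysis.FluidPDE.LerayHopfNSRescale
import Literature.Analysis.FluidPDE.PalasekQuantitativeAxisymReduction
import HarnessLib

/-!
# Leray's similarity `u ↦ c u(c²·, c·)` for the standing axisymmetric class: route-independent tools

Helper toward the crux `AxisymSwirlRegular` (stmt-NavierStokesRegularity-1964, route TypeIIInviscidRelaxation),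
criterion side of the registered line `radial_inflow_split` (stub `stub_oneSidedRadialCriterion`, ⟨19059⟩): the
small dictionary needed to move the landed unit-tube criteria (`RadialInflowCoreReynolds.*`, `RadialInflowCoreStrain.*`)
onto a tube of any radius by the Navier–Stokes scaling at fixed viscosity.

* `nsRescaleData_hasRapidSpatialDecay` — rapid decay of the dilated datum (copy, outside every route cone, of
  `Target.Negative.hasRapidSpatialDecay_nsRescaleData`, whose module imports a route file);
* `standingClass_nsRescale` — the standing class (classical on `[0,T)`, Leray–Hopf from its datum, rapidly decaying
  datum, axisymmetric slices) is transported to `[0, T/c²)`;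
* `hasSmoothExtensionPast_of_nsRescale` — a smooth continuation of `c u(c²·, c·)` past `T/c²` gives one of `u` past
  `T` (the direction needed to pull a criterion back; the forward direction is
  `CertifiedBlowupAxisymBlowup.CompactAmplification.hasSmoothExtensionPast_nsRescale`);
* `neg_norm_le_radialVelocity` — `u_r ≥ −‖u‖` off the axis;
* `radialVelocity_nsRescale` — `(c u(c²s, c·))_r(y) = c·u_r(c²s, cy)`.

Tools only; nothing here proves any route statement. [folklore]
-/

noncomputable section

set_option linter.dupNamespace false

open Set Filter Topology Real
open Literature.Analysis.FluidPDE
open scoped ContDiff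

namespace Summit.NavierStokesRegularity.NavierStokesRegularity.Theorems.RadialInflowSimilarity

open Summit.NavierStokesRegularity.NavierStokesRegularity.Theorems
open Summit.NavierStokesRegularity.NavierStokesRegularity.Theorems.ScenarioCensus.LogGate

/-! ## §1 Leray's similarity on `[0,T)` -/

/-- Rapid decay is preserved by the dilation of data `x ↦ c u₀(c x)`, `c > 0` (chain rule for `iteratedFDeriv` through
`c • id` and `1 + ‖x‖ ≤ max 1 c⁻¹ · (1 + c‖x‖)`; copy of `Target.Negative.hasRapidSpatialDecay_nsRescaleData` outside the
route cone). [folklore] -/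
theorem nsRescaleData_hasRapidSpatialDecay {u₀ : EuclideanSpace ℝ (Fin 3) → EuclideanSpace ℝ (Fin 3)}
    (hu : ContDiff ℝ ∞ u₀) (hd : HasRapidSpatialDecay u₀) {c : ℝ} (hc : 0 < c) :
    HasRapidSpatialDecay (nsRescaleData c u₀) := by
  -- adapted from Theorems/Target/Negative/NormalForms.lean
  intro n K
  obtain ⟨C, hC⟩ := hd n K
  set m : ℝ := max 1 c⁻¹ with hm
  have hm0 : 0 ≤ m := le_trans zero_le_one (le_max_left _ _)
  refine ⟨m ^ K * (c * c ^ n) * C, fun x => ?_⟩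
  set L : EuclideanSpace ℝ (Fin 3) →L[ℝ] EuclideanSpace ℝ (Fin 3) := c • ContinuousLinearMap.id ℝ _ with hL
  have hLx : ∀ y : EuclideanSpace ℝ (Fin 3), L y = c • y := fun y => by simp [hL]
  have hfun : nsRescaleData c u₀ = c • (u₀ ∘ ⇑L) := by
    funext y
    simp [nsRescaleData_apply, hLx]
  have hun : ContDiff ℝ n u₀ := hu.of_le (by exact_mod_cast le_top)
  have hcomp : ContDiff ℝ n (u₀ ∘ ⇑L) := hun.comp L.contDiff
  have hnorm_L : ‖L‖ ≤ c := by
    rw [hL]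
    calc ‖c • ContinuousLinearMap.id ℝ (EuclideanSpace ℝ (Fin 3))‖
        ≤ ‖c‖ * ‖ContinuousLinearMap.id ℝ (EuclideanSpace ℝ (Fin 3))‖ := (norm_smul c _).le
      _ ≤ c * 1 := by
          rw [Real.norm_eq_abs, abs_of_pos hc]
          exact mul_le_mul_of_nonneg_left ContinuousLinearMap.norm_id_le hc.le
      _ = c := mul_one c
  have hD : ‖iteratedFDeriv ℝ n (nsRescaleData c u₀) x‖ ≤ c * c ^ n * ‖iteratedFDeriv ℝ n u₀ (L x)‖ := by
    rw [hfun, iteratedFDeriv_const_smul_apply hcomp.contDiffAt, norm_smul, Real.norm_eq_abs,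
      abs_of_pos hc, L.iteratedFDeriv_comp_right hun x le_rfl, mul_assoc]
    refine mul_le_mul_of_nonneg_left ?_ hc.le
    calc ‖(iteratedFDeriv ℝ n u₀ (L x)).compContinuousLinearMap fun _ => L‖
        ≤ ‖iteratedFDeriv ℝ n u₀ (L x)‖ * ∏ _i : Fin n, ‖L‖ :=
          ContinuousMultilinearMap.norm_compContinuousLinearMap_le _ _
      _ ≤ ‖iteratedFDeriv ℝ n u₀ (L x)‖ * c ^ n := by
          rw [Finset.prod_const, Finset.card_univ, Fintype.card_fin]
          exact mul_le_mul_of_nonneg_left (pow_le_pow_left₀ (norm_nonneg _) hnorm_L n) (norm_nonneg _)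
      _ = c ^ n * ‖iteratedFDeriv ℝ n u₀ (L x)‖ := mul_comm _ _
  have hw : 1 + ‖x‖ ≤ m * (1 + ‖L x‖) := by
    rw [hLx, norm_smul, Real.norm_eq_abs, abs_of_pos hc, mul_add, mul_one]
    have h1 : (1 : ℝ) ≤ m := le_max_left _ _
    have h2 : ‖x‖ ≤ m * (c * ‖x‖) := by
      calc ‖x‖ = c⁻¹ * (c * ‖x‖) := by rw [← mul_assoc, inv_mul_cancel₀ hc.ne', one_mul]
        _ ≤ m * (c * ‖x‖) := mul_le_mul_of_nonneg_right (le_max_right _ _) (by positivity)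
    linarith
  have hwK : (1 + ‖x‖) ^ K ≤ m ^ K * (1 + ‖L x‖) ^ K := by
    rw [← mul_pow]
    exact pow_le_pow_left₀ (by positivity) hw K
  have hCx := hC (L x)
  calc (1 + ‖x‖) ^ K * ‖iteratedFDeriv ℝ n (nsRescaleData c u₀) x‖
      ≤ (m ^ K * (1 + ‖L x‖) ^ K) * (c * c ^ n * ‖iteratedFDeriv ℝ n u₀ (L x)‖) :=
        mul_le_mul hwK hD (norm_nonneg _) (by positivity)
    _ = m ^ K * (c * c ^ n) * ((1 + ‖L x‖) ^ K * ‖iteratedFDeriv ℝ n u₀ (L x)‖) := by ring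
    _ ≤ m ^ K * (c * c ^ n) * C := mul_le_mul_of_nonneg_left hCx (by positivity)

/-- **Undoing Leray's similarity on a smooth continuation.** If `c u(c²·, c·)` (`c > 0`) extends smoothly past
`T/c²`, then `u` extends smoothly past `T`: rescale the extension back with `c⁻¹`
(`IsClassicalNSSolutionOn.nsRescale_holds`, `nsRescale c⁻¹ ∘ nsRescale c = id`). [cite: Leray1934, §20] -/
theorem hasSmoothExtensionPast_of_nsRescale {ν T c : ℝ}
    {u : ℝ → EuclideanSpace ℝ (Fin 3) → EuclideanSpace ℝ (Fin 3)} (hc : 0 < c)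
    (h : HasSmoothExtensionPast ν 0 (nsRescale c u) (T / c ^ 2)) : HasSmoothExtensionPast ν 0 u T := by
  obtain ⟨T', hT', u', p', hcl', hagree⟩ := h
  have hc2 : 0 < c ^ 2 := pow_pos hc 2
  have hci : 0 < c⁻¹ := inv_pos.2 hc
  have hci2 : 0 < c⁻¹ ^ 2 := pow_pos hci 2
  have key := IsClassicalNSSolutionOn.nsRescale_holds hcl' hci
  rw [Set.preimage_const_mul_Ico₀ _ _ hci2, zero_div, nsRescaleForce_zero] at key
  have hcc : c⁻¹ ^ 2 = (c ^ 2)⁻¹ := by rw [inv_pow]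
  refine ⟨T' / c⁻¹ ^ 2, ?_, nsRescale c⁻¹ u', nsRescalePressure c⁻¹ p', key, fun t ht => ?_⟩
  · rw [hcc, div_inv_eq_mul]
    have h1 := (div_lt_iff₀ hc2).1 hT'
    linarith
  · have hct : c⁻¹ ^ 2 * t ∈ Ico 0 (T / c ^ 2) := by
      refine ⟨mul_nonneg hci2.le ht.1, ?_⟩
      rw [hcc, lt_div_iff₀ hc2]
      have h2 : (c ^ 2)⁻¹ * t * c ^ 2 = t := by field_simp
      rw [h2]
      exact ht.2
    funext x
    rw [nsRescale_apply, hagree _ hct, nsRescale_apply, smul_smul, smul_smul, mul_inv_cancel₀ hc.ne', one_smul,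
      inv_mul_cancel₀ hc.ne', one_smul]
    congr 1
    field_simp

/-- **Leray's similarity transports the standing axisymmetric class** from `[0,T)` to `[0,T/c²)` (`c > 0`): classical
solution of the unforced system (`IsClassicalNSSolutionOn.nsRescale_holds`), Leray–Hopf from its own datum
(`isLerayHopfOn_nsRescale`), rapidly decaying datum (`nsRescaleData_hasRapidSpatialDecay`), axisymmetric slices
(`IsAxisymmetric.nsRescale_slice`). [cite: Leray1934, §20] -/
theorem standingClass_nsRescale {ν T c : ℝ} (hT : 0 < T)
    {u : ℝ → EuclideanSpace ℝ (Fin 3) → EuclideanSpace ℝ (Fin 3)} {p : ℝ → EuclideanSpace ℝ (Fin 3) → ℝ}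
    (hcl : IsClassicalNSSolutionOn (Ico 0 T) ν 0 u p) (hLH : IsLerayHopfOn T ν 0 (u 0) u)
    (hdec : HasRapidSpatialDecay (u 0)) (hax : ∀ t ∈ Ico 0 T, IsAxisymmetric (u t)) (hc : 0 < c) :
    IsClassicalNSSolutionOn (Ico 0 (T / c ^ 2)) ν 0 (nsRescale c u) (nsRescalePressure c p) ∧
      IsLerayHopfOn (T / c ^ 2) ν 0 (nsRescale c u 0) (nsRescale c u) ∧
      HasRapidSpatialDecay (nsRescale c u 0) ∧
      ∀ s ∈ Ico 0 (T / c ^ 2), IsAxisymmetric (nsRescale c u s) := by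
  have hc2 : 0 < c ^ 2 := pow_pos hc 2
  refine ⟨?_, ?_, ?_, fun s hs => ?_⟩
  · have key := IsClassicalNSSolutionOn.nsRescale_holds hcl hc
    rwa [Set.preimage_const_mul_Ico₀ _ _ hc2, zero_div, nsRescaleForce_zero] at key
  · have h := isLerayHopfOn_nsRescale hLH hc
    rwa [nsRescaleForce_zero, ← nsRescale_zero_time c u] at h
  · rw [nsRescale_zero_time]
    exact nsRescaleData_hasRapidSpatialDecay (hcl.contDiff_velocity ⟨le_rfl, hT⟩) hdec hc
  · exact IsAxisymmetric.nsRescale_slice (hax _ ⟨mul_nonneg hc2.le hs.1, (lt_div_iff₀' hc2).1 hs.2⟩)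

/-- Off the axis the radial velocity is at least `−‖u(x)‖` (Cauchy–Schwarz in the horizontal plane,
`neg_cylRadius_mul_norm_le_radialMomentum`). [folklore] -/
theorem neg_norm_le_radialVelocity (v : EuclideanSpace ℝ (Fin 3) → EuclideanSpace ℝ (Fin 3))
    {x : EuclideanSpace ℝ (Fin 3)} (hx : 0 < cylRadius x) : -‖v x‖ ≤ radialVelocity v x := by
  rw [radialVelocity_eq_div', le_div_iff₀ hx]
  have h := neg_cylRadius_mul_norm_le_radialMomentum x (v x)
  linarith

/-- The radial velocity under Leray's similarity: `(c u(c²s, c·))_r (y) = c · u_r(c²s, c y)` for `c > 0`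
(the radial unit vector is dilation invariant). [folklore] -/
theorem radialVelocity_nsRescale {c : ℝ} (hc : 0 < c)
    (u : ℝ → EuclideanSpace ℝ (Fin 3) → EuclideanSpace ℝ (Fin 3)) (s : ℝ) (y : EuclideanSpace ℝ (Fin 3)) :
    radialVelocity (nsRescale c u s) y = c * radialVelocity (u (c ^ 2 * s)) (c • y) := by
  rw [radialVelocity_eq_div', radialVelocity_eq_div', cylRadius_smul, abs_of_pos hc]
  simp only [nsRescale_apply, PiLp.smul_apply, smul_eq_mul]
  by_cases hy : cylRadius y = 0
  · simp [hy]
  · field_simp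


end Summit.NavierStokesRegularity.NavierStokesRegularity.Theorems.RadialInflowSimilarity

end
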